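import Mathlib
import HarnessLib
import HarnessLib.Audit
import Summits.SmoothPoincare4.Statement
import Literature.Geometry.Lorentzian.LeviCivita
import Literature.Geometry.Lorentzian.Volume
import Literature.Geometry.Riemannian.IsotropicCurvature
import Literature.Topology.FourManifolds.HomotopyS4CompactProofs
import Literature.Geometry.Lorentzian.Geodesic
import HarnessLib.Audit.Status.Attr

/-!
Route: EinsteinBulk

DORMANT since 2026-08-23T12:36:55Z (reconciler: no traction for 6.1 d (last activity item-evidence-added at 2026-08-17T10:13:20Z); parked, not closed — `ledger route dormant route-SmoothPoincare4-EinsteinBulk --off` to reactivate) — unstaffed, not closed; items shared with open routes are served there. `ledger route dormant <id> --off` reactivates.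

# Route EinsteinBulk — near-round Einstein-fillable homotopy 4-spheres are standard; PE-FILL(δ) and
Yamabe-extremality supply the filling

It suffices to show X = NEAR-ROUND EINSTEIN FILLINGS (card einstein-bulk-irons-boundary, step 3):
every closed smooth 4-manifold M
homotopy equivalent to S⁴ carries, for every δ > 0, a Riemannian metric g₀ whose conformal class has
Yamabe constant
Y(M,[g₀]) ≥ (1 − δ)·Y(S⁴) = (1 − δ)·8√6π AND which is the conformal infinity of a conformally
compact Einstein 5-manifold
(N, g) (Ric_g = −4g; C² conformal compactification X̄ ⊃ N with ∂X̄ = M, smooth defining function ρ,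
|dρ|_ḡ = 1 on ∂X̄).
X = Y1 ∧ PE-FILL(δ) restricted to homotopy spheres: Y1 = YamabeExtremalSpheres (σ(Σ) = Y(S⁴), crux
shared with card
yamabe-extremal-or-thin) and PE-FILL = PEFillNearRound (every Yamabe-near-round class on a homotopy
4-sphere bounds a
Poincaré–Einstein 5-manifold). X → SPC4 by two recognisers: Li–Qing–Shi's pinching |K+1| ≤ ε from
Y(∂X) ≥ (1−δ)Y(S⁴)
(crux YamabePinchedEinsteinBulk, a named fact filed first) and the visual-boundary lemma "a
non-positively curved AH Einstein
filling of a homotopy 4-sphere has standard boundary" (crux EinsteinHadamardFillingStandard; general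
form HadamardFillingStandard
as support, reusable by information-metric-hadamard).
Lean: `∀ (M : Type) [TopologicalSpace M] [T2Space M] [SecondCountableTopology M] [ChartedSpace
(EuclideanSpace ℝ (Fin 4)) M] [IsManifold (𝓡 4) ∞ M] [CompactSpace M] [ConnectedSpace M]
[MeasurableSpace M] [BorelSpace M], M ≃ₕ Metric.sphere (0 : EuclideanSpace ℝ (Fin 5)) 1 → ∀ δ : ℝ, 0
< δ → ∃ g₀ : Bundle.ContMDiffRiemannianMetric (𝓡 4) ∞ (EuclideanSpace ℝ (Fin 4)) (TangentSpace (𝓡 4)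
: M → Type _), (∀ (h' : Bundle.ContMDiffRiemannianMetric (𝓡 4) ∞ (EuclideanSpace ℝ (Fin 4))
(TangentSpace (𝓡 4) : M → Type _))
[(Literature.Geometry.Lorentzian.PseudoRiemannianMetric.ofRiemannian h').HasLeviCivita], (∃ φ : M →
ℝ, ∀ x : M, 0 < φ x ∧ ∀ v w : TangentSpace (𝓡 4) x, h'.inner x v w = φ x * g₀.inner x v w) → (1 - δ)
* (8 * Real.sqrt 6 * Real.pi) * Real.sqrt ((Literature.Geometry.Lorentzian.riemannianMeasure h'
Set.univ).toReal) ≤ ∫ x, (Literature.Geometry.Lorentzian.PseudoRiemannianMetric.ofRiemannian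
h').scalarCurvature x ∂(Literature.Geometry.Lorentzian.riemannianMeasure h')) ∧ ∃ (N : Type) (_ :
TopologicalSpace N) (_ : T2Space N) (_ : SecondCountableTopology N) (_ : ChartedSpace
(EuclideanSpace ℝ (Fin 5)) N) (_ : IsManifold (𝓡 5) ∞ N) (g : Bundle.ContMDiffRiemannianMetric (𝓡 5)
∞ (EuclideanSpace ℝ (Fin 5)) (TangentSpace (𝓡 5) : N → Type _)) (_ :
(Literature.Geometry.Lorentzian.PseudoRiemannianMetric.ofRiemannian g).HasLeviCivita), (∀ x,
(Literature.Geometry.Lorentzian.PseudoRiemannianMetric.ofRiemannian g).ricci x = (-4 : ℝ) •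
(Literature.Geometry.Lorentzian.PseudoRiemannianMetric.ofRiemannian g).toBilinForm x) ∧ (∃ (X :
Type) (_ : TopologicalSpace X) (_ : T2Space X) (_ : SecondCountableTopology X) (_ : ChartedSpace
(EuclideanHalfSpace 5) X) (_ : IsManifold (𝓡∂ 5) ∞ X) (_ : CompactSpace X) (_ : ConnectedSpace X) (j
: N → X) (ι : M → X) (ρ : X → ℝ) (gb : Bundle.ContMDiffRiemannianMetric (𝓡∂ 5) 2 (EuclideanSpace ℝ
(Fin 5)) (TangentSpace (𝓡∂ 5) : X → Type _)), Manifold.IsSmoothEmbedding (𝓡 5) (𝓡∂ 5) ∞ j ∧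
Set.range j = (𝓡∂ 5).interior X ∧ Manifold.IsSmoothEmbedding (𝓡 4) (𝓡∂ 5) ∞ ι ∧ Set.range ι = (𝓡∂
5).boundary X ∧ ContMDiff (𝓡∂ 5) 𝓘(ℝ, ℝ) ∞ ρ ∧ (∀ x : X, 0 ≤ ρ x) ∧ (∀ x : X, ρ x = 0 ↔ x ∈ (𝓡∂
5).boundary X) ∧ (∀ y : M, ∃ ν : TangentSpace (𝓡∂ 5) (ι y), gb.inner (ι y) ν ν = 1 ∧ ∀ v :
TangentSpace (𝓡∂ 5) (ι y), gb.inner (ι y) ν v = mfderiv (𝓡∂ 5) 𝓘(ℝ, ℝ) ρ (ι y) v) ∧ (∀ (x : N) (v w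
: TangentSpace (𝓡 5) x), gb.inner (j x) (mfderiv (𝓡 5) (𝓡∂ 5) j x v) (mfderiv (𝓡 5) (𝓡∂ 5) j x w) =
ρ (j x) ^ 2 * g.inner x v w) ∧ (∃ φ : M → ℝ, ∀ y : M, 0 < φ y ∧ ∀ v w : TangentSpace (𝓡 4) y,
gb.inner (ι y) (mfderiv (𝓡 4) (𝓡∂ 5) ι y v) (mfderiv (𝓡 4) (𝓡∂ 5) ι y w) = φ y * g₀.inner y v w))`

## Assembly
Pure logic plus instance bookkeeping. Fix M ≃ₕ S⁴ from the summit binder (T₂, second countable, C^∞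
atlas on ℝ⁴); M is compact
(`Literature.Topology.FourManifolds.compactSpace_of_homotopyEquiv_sphere_four_holds`, proved),
connected
(`pathConnectedSpace_of_homotopyEquiv` + `pathConnectedSpace_sphere_four`), `borel M` gives the
measurable structure, T₃ from
compact T₂. Take δ_L from YamabePinchedEinsteinBulk at ε = 1/2 and δ_P from PEFillNearRound;
YamabeExtremalSpheres at
η = min(δ_L, δ_P) gives g₀ whose Yamabe bound holds a fortiori at both levels (λ ↦ λ·√Vol is
monotone); PEFillNearRound gives
the Einstein filling (N, g) with its package; the fact gives |Rm(X,Y,Y,X) + 1| ≤ 1/2 on orthonormal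
pairs, hence Rm(X,Y,Y,X) ≤ 0;
EinsteinHadamardFillingStandard returns `Nonempty (M ≃ₘ S⁴)`, which is `SmoothPoincare4` unfolded.
Equivalently Assembly =
TargetAssembly ∘ FillingGlue (both support items; the glue is checked). ≈ 40 lines.

Rationale: WHY THIS LINE. The bulk irons the boundary: a complete K ≤ 0 filling N⁵ of a simply connected closed
M⁴ is ℝ⁵ (Cartan–Hadamard plus an end
count), and for asymptotically hyperbolic N the endpoint map of geodesic rays identifies the visual
sphere S⁴ = ∂_∞ℝ⁵ with the
conformal boundary M as SMOOTH manifolds (GrahamEtAl2020 Def 5.3, Prop 5.13: non-trapping + K ≤ 0 ⇒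
simple ⇒ exp extends to a
diffeomorphism up to ∂X̄), so Σ ≅ S⁴ — and LiQingShi2017 Thm 1.8 (built on the Dutta–Javaheri
relative volume inequality, Thm
1.5) delivers exactly that curvature sign on any Poincaré–Einstein bulk from ONE boundary scalar,
the Yamabe constant. Imported
areas: conformally compact Einstein geometry / mathematical AdS-CFT (GrahamLee1991, Lee2006,
Anderson2008, GurskySzekelyhidi2020,
ChruscielEtAl2005, WittenYau1999 — dictionary: conformal class ↦ boundary datum, PE filling ↦ bulk
saddle, PE-FILL(δ) = "boundary
data near the conformal vacuum admit a smooth bulk"), comparison geometry of AH manifolds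
(LiQingShi2017), hyperbolic dynamics of
geodesic flows (GrahamEtAl2020), Yamabe invariants (Aubin1976, Kobayashi1987, Schoen1989). All 23
open SPC4 routes either move
handles/corks/trisections of Σ or impose a pointwise curvature condition ON Σ (PIC, RicciFat,
BachCriticalElement, WeylBudget);
this line puts all geometry on a 5-dimensional bulk and asks of the exotic sphere only a
near-extremal Yamabe class; the negatives
index is empty (2026-08-15).

RANKED CRUXES. #0 PEFilledHomotopySpheres (target) — X: every closed smooth M ≃ₕ S⁴ has, for every δ
> 0, a metric g₀ with Y(M,[g₀]) ≥ (1−δ)·8√6π that is the conformal infinity of a C²-conformally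
compact Einstein (Ric = −4g) 5-manifold with |dρ|_ḡ = 1 at the boundary (card step 3, Y1 ∧ PE-FILL
on spheres). (why it might fail: Zero slack: given cruxes 2 and 5 it is equivalent to SPC4 (S⁴
bounds ℍ⁵ with Y = Y(S⁴)); false iff an exotic 4-sphere exists; even for true Σ = S⁴-candidates no
large-data PE existence engine exists in bulk dimension 5.) [LiQingShi2017, GrahamLee1991, Lee2006,
GurskySzekelyhidi2020]
#2 YamabePinchedEinsteinBulk (crux) — NAMED FACT (LiQingShi2017 Thm 1.8 at n = 5, filed first per
the cone rule, to be vendored in Literature and threaded as a hypothesis): for every ε > 0 there is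
δ > 0 such that every conformally compact Einstein 5-manifold (N, g), Ric_g = −4g, with C²
compactification X̄ (compact, connected, ∂X̄ = M closed connected, smooth bdf ρ with |dρ|_ḡ = 1 on
∂X̄) whose conformal infinity (M,[g₀]) has Y(M,[g₀]) ≥ (1−δ)·8√6π, satisfies |K + 1| ≤ ε for every
sectional curvature K of g (orthonormal 2-frames). [difficulty: XL] (why it might fail: Only by
mis-transcription: LQS need Ric = −(n−1)g with n = dim X = 5, C² conformal compactness (their Def
2.1 — the package grants exactly C², smooth ρ), Y in the 6|∇u|²+Ru² normalisation (= inf over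
conformal h' of ∫R dV/√Vol, Y(S⁴) = 8√6π); δ(ε) is ineffective.) [LiQingShi2017, arXiv:1410.6402,
ChruscielEtAl2005]
#3 PEFillNearRound (crux) — PE-FILL(δ) on homotopy 4-spheres (card step 3, the load-bearing
conjecture): there is δ > 0 such that for every closed smooth M ≃ₕ S⁴ and every metric g₀ on M with
Y(M,[g₀]) ≥ (1−δ)·8√6π there is a conformally compact Einstein 5-manifold (N, g), Ric = −4g, with C²
compactification X̄, ∂X̄ = M, |dρ|_ḡ = 1 on ∂X̄ and conformal infinity [g₀]. [deps:
YamabePinchedEinsteinBulk] [difficulty: open-problem] (why it might fail: Large-data PE existence is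
open even on B⁵: engines are perturbative (GrahamLee1991, Lee2006) or collar-local
(GurskySzekelyhidi2020); one Yamabe-near-round class on S⁴ bounding no Einstein bulk of any topology
kills it; known obstructions (GurskyHan2017, GurskyHanStolz2021) need bulk dim 4k.) [GrahamLee1991,
Lee2006, GurskySzekelyhidi2020, GurskyHan2017, GurskyHanStolz2021, Anderson2008, WittenYau1999]
#4 YamabeExtremalSpheres (crux) — Y1 (card step 3; shared with card yamabe-extremal-or-thin): every
closed smooth M ≃ₕ S⁴ is Yamabe-extremal, σ(M) = sup_[g] Y(M,[g]) = Y(S⁴): for every η > 0 there is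
a metric g₀ with ∫_M R_h dV_h ≥ (1−η)·8√6π·√Vol(M,h) for every metric h conformal to g₀.
[difficulty: open-problem] (why it might fail: False iff some homotopy 4-sphere is Yamabe-thin (σ(Σ)
< Y(S⁴)); σ is a diffeomorphism invariant that nothing computes on a candidate, and every
construction reaching Y(S⁴) (Kobayashi1987 sums, Schoen1989 necks) starts from S⁴ or S¹×S³ pieces.)
[Kobayashi1987, Schoen1989, Aubin1976, arXiv:math/0309287]
#5 EinsteinHadamardFillingStandard (crux) — Recognition (card step 1 + LQS sign, Einstein form): if
a closed smooth M ≃ₕ S⁴ is the conformal infinity of a conformally compact Einstein 5-manifold (N,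
g) (package as in crux 2) all of whose sectional curvatures are ≤ 0, then M is diffeomorphic to S⁴
(N ≅ ℝ⁵ by Cartan–Hadamard + end count; the endpoint map S_pN → ∂X̄ is a diffeomorphism).
[difficulty: XL] (why it might fail: GrahamEtAl2020 Prop 5.13 gives the endpoint diffeomorphism for
SMOOTH AH compactifications; a CCE⁵ bulk is only C^{3,α}/polyhomogeneous at ∂X̄ (x⁴log x terms,
ChruscielEtAl2005) and the package grants C²; the C¹ extension of the rescaled geodesic flow must be
redone at that regularity.) [GrahamEtAl2020, arXiv:1709.05053, ChruscielEtAl2005, Stallings1962,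
LiQingShi2017]
#9 HadamardFillingStandard (support) — The card's LEMMA in full (no Einstein condition): a closed
smooth M ≃ₕ S⁴ that is the conformal infinity of a C²-conformally compact, boundary-normalised
(|dρ|_ḡ = 1) 5-manifold (N, g) with all sectional curvatures ≤ 0 is diffeomorphic to S⁴. Implies
crux 5 by weakening; it is the recogniser shared with card information-metric-hadamard. [difficulty:
XL] [GrahamEtAl2020, Stallings1962, arXiv:1103.3507]
#9 FillingGlue (support) — Glue Y1 ∧ PE-FILL → X: pure logic plus monotonicity of the Yamabe bound
in λ (take η = min(δ, δ_PE)); a 15-line proof was checked privately in the planner folder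
(GlueTest.lean). [difficulty: provable-now] [LiQingShi2017]
#9 TargetAssembly (support) — The bridge from X: YamabePinchedEinsteinBulk at ε = 1/2 gives
|Rm(X,Y,Y,X)+1| ≤ 1/2 hence K ≤ 0 on the filling produced by X at δ = δ(1/2);
EinsteinHadamardFillingStandard returns M ≃ₘ S⁴, i.e. `SmoothPoincare4` unfolded (instances:
compactness from
`Literature.Topology.FourManifolds.compactSpace_of_homotopyEquiv_sphere_four_holds`, connectedness
from `pathConnectedSpace_of_homotopyEquiv`, `borel M`). [difficulty: provable-now] [LiQingShi2017,
Kirby1997]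
#9 RoundSphereBoundsHyperbolicSpace (support) — Non-vacuity / normalisation check of the filling
package: the round S⁴ ⊂ ℝ⁵ (some metric g₀ on it) is the conformal infinity of an Einstein (Ric =
−4g) conformally compact 5-manifold with K ≡ −1 — hyperbolic 5-space in the ball model, X̄ = closed
5-ball, ρ = (1−|x|²)/2 near the boundary suitably smoothed, ḡ = ρ²g. [difficulty: L] [GrahamLee1991,
LiQingShi2017]

TWO-LAYER PLAN. Foreseen glued splits (nothing filed now). (a) PEFillNearRound ON S⁴ ITSELF splits
by the continuity method along paths of
Yamabe-near-round classes from the round class: Openness (Lee2006 Thm A: a CCE with K ≤ 0 has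
unobstructed deformation theory,
and crux 2 makes every near-round filling negatively curved, so the fillable set is open in C^{2,α})
→ Compactness (limits of
CCE⁵ with Y(∂) ≥ (1−δ)Y(S⁴): pinching from crux 2, boundary regularity from ChruscielEtAl2005; the
missing piece is the
5-dimensional analogue of the Chang–Ge(–Qing) compactness theorems for CCE⁴,
doi:10.1016/j.aim.2018.10.010,
doi:10.1016/j.aim.2020.107325) → Connectedness of the superlevel set {Y ≥ (1−δ)Y(S⁴)} of conformal
classes on S⁴ (unknown)
→ PEFillNearRound|_{S⁴}. (b) On an exotic Σ the same path needs a base point, which is the target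
itself, so there the crux is
attacked whole: AH Ricci flow with fixed conformal infinity started from an AH metric adapted to the
contractible filling V⁵
(Kervaire–Milnor + Stallings1962; Bahuaud 2011, Qing–Shi–Wu 2013) — long-time convergence for
Yamabe-near-round boundary data
would be the filling. (c) EinsteinHadamardFillingStandard ⇐ PolyhomogeneousUpgrade (C² CCE⁵ with
smooth infinity is C^{3,α}
polyhomogeneous in boundary-harmonic coordinates, ChruscielEtAl2005 Thm A) → SimpleAHBoundarySphere
(GrahamEtAl2020 Prop 5.13
re-run at polyhomogeneous regularity, plus "K ≤ 0 + simply connected boundary ⇒ π₁ = 1 ⇒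
non-trapping", the end count checked
by hand in NOTES) → crux 5. (d) YamabePinchedEinsteinBulk is never split: it is vendored as a
Literature fact and the
assembly restated with `(h : fact) →`.

KILL CRITERIA. A conformal class on S⁴ with Y ≥ (1−δ)Y(S⁴) for every δ along a sequence (e.g.
dumbbell classes S⁴#_neck S⁴) provably
bounding no Poincaré–Einstein 5-manifold of any topology refutes PEFillNearRound — close
`refuted:PEFillNearRound` (the
recogniser items survive as support knowledge for information-metric-hadamard; Y1 survives in
yamabe-extremal-or-thin). An
exotic 4-sphere proved anywhere refutes the target and Y1-or-PE-FILL at once — close refuted. A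
Yamabe-thin homotopy sphere
(σ(Σ) < Y(S⁴)) refutes YamabeExtremalSpheres — close `refuted:YamabeExtremalSpheres` (and it is
itself an exotic
certificate). A C²-AH Hadamard 5-manifold whose conformal-boundary smooth structure is not the
visual one refutes the
support HadamardFillingStandard and forces repair (a) of crux 5: restate with
C^{3,α}/polyhomogeneous compactification
(available for Einstein bulks by ChruscielEtAl2005). If LQS Thm 1.8 turns out to need C³ compactness
(their Thm 1.5 does)
restate crux 2 and the package at C³ — harmless for Einstein bulks. A theorem "every CCE⁵ with Y(∂X)
> (1−δ)Y(S⁴) has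
∂X ≅ S⁴ or X̄ ≅ B⁵" printed elsewhere moots cruxes 2+5 (cite it; the route contracts to Y1 ∧
PE-FILL).

NOT DECOMPOSED YET. The constant δ(ε) of LQS (ineffective; no value claimed); the π₁/end-count
lemma, Cartan–Hadamard, ray asymptotics and the
C¹-regularity of the endpoint map (support lemmas a prover of crux 5 attaches with `--supports`);
the S⁴-only continuity split
(a) above and the AH-Ricci-flow line (b); the physics reading (which boundary CFT data have bulk
saddles) — deliberately not an
item; the general-topology version of PE-FILL for all closed 4-manifolds (the card's form) — NOT
filed, because a non-null-cobordant
M with σ(M) = Y(S⁴) would kill it for a reason irrelevant to SPC4; the Yamabe constant and the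
filling package as Literature
definitions (requests D1, D2) — until they land every item inlines them verbatim (identical text,
generated from one template).

CHEAPEST FALSIFIER. (i) Lookup, DONE this session: LiQingShi2017 read pp. 3–6, 8, 12–13 — Thm 1.8 is
stated for "any conformally compact Einstein
manifold", Def 2.1 = C² compactification with smooth bdf, Ric = −(n−1)g₊, Yamabe functional
(4(n−1)/(n−2)|∇u|² + Ru²); no
conclusion about the topology of ∂X anywhere (so cruxes 2+5 are not already one printed theorem);
GrahamEtAl2020 read pp. 3, 5,
10, 13, 27, 30 — AH := SMOOTH compactification with |dρ| = 1, non-trapping ⇒ simply connected (p.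
10), Def 5.3, Prop 5.13:
the regularity gap of crux 5 is real and recorded. (ii) By hand, DONE: thermal AdS ℍ⁵/ℤ fills
S¹_β×S³ whose product classes have
Y ↑ Y(S⁴) as β → ∞ (Schoen1989) with K ≡ −1 and non-simply-connected boundary — LQS pinching alone
forces nothing, the
hypothesis M ≃ₕ S⁴ of crux 5 is load-bearing, and no contradiction arises. (iii) TO RUN (kit, not
run in this one-shot seat):
numerically continue the Graham–Lee filling on B⁵ along the dumbbell family of conformal classes on
S⁴ (Y ≥ 0.99·Y(S⁴), C²-far
from round) and watch the smallest eigenvalue of the gauged linearised Einstein operator;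
degeneration/divergence is evidence
against PEFillNearRound on S⁴ itself, the one place the crux has slack.

NUMBERS. Y(S⁴) = 12·(8π²/3)^{1/2} = 8√6π ≈ 61.56 (round unit S⁴: R = 12, Vol = 8π²/3; CGY/LQS
normalisation, attained only by round
classes: Aubin1976/Obata). Einstein constant −4 = −(n−1), n = dim X = 5; K ≡ −1 on ℍ⁵; the assembly
uses ε = 1/2 (any ε < 1
works). LQS δ(ε): ineffective (blow-up argument, pp. 12–13). Y(S¹_β×S³,[prod]) → Y(S⁴) as β → ∞,
never attained (Schoen1989);
σ(CP²) = 12√2π ≈ 53.3 < 0.87·Y(S⁴) (LeBrun) — irrelevant here since PE-FILL is filed on homotopy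
spheres only. Regularity:
CCE⁵ compactifications are C^{3,α}, polyhomogeneous with x⁴log x (ChruscielEtAl2005); package = C²
(LQS Def 2.1). Items at
open: 10 typed (4 cruxes, 1 target, 4 support, 1 assembly).

DEFINITION REQUESTS. D1 (for all items): `IsConformallyCompactFilling M g₀ N g` (topic
Literature/Geometry/Riemannian) — the package inlined in
every item: compact connected C^∞ 5-manifold with boundary X̄ (model `𝓡∂ 5`), open smooth embedding
j : N → X̄ onto
`(𝓡∂ 5).interior X̄`, smooth embedding ι : M → X̄ onto `(𝓡∂ 5).boundary X̄`, smooth ρ ≥ 0 with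
ρ⁻¹(0) = ∂X̄ and unit
ḡ-gradient on ∂X̄, a C² Riemannian ḡ on X̄ with j*ḡ = (ρ∘j)²g and ι*ḡ = φ·g₀ (φ > 0); plus
`.IsEinstein` (Ric = −4g).
D2 (shared with BachCriticalElement / yamabe-extremal-or-thin / PIC): `yamabeConstant M g₀ : ℝ` of a
conformal class on a
closed manifold, = inf over smooth h conformal to g₀ of ∫R_h dV_h / Vol(h)^{(n−2)/n} (n = 4: /√Vol),
with the lemma that it
equals the W^{1,2} infimum of the Yamabe functional. Cite facts wanted (family spc4): F1
LiQingShi2017 Thm 1.8 at n = 5 (=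
crux 2 verbatim); F2 GrahamEtAl2020 Prop 5.13 + p. 10 remark (simple AH ⇒ exp_p extends to a
diffeomorphism S_p ≅ ∂X̄;
non-trapping ⇒ π₁ = 1); F3 ChruscielEtAl2005 Thm A (boundary regularity of C² CCE, dim X = 5:
C^{3,α} polyhomogeneous);
F4 Aubin1976/Obata: Y(S⁴,[round]) = 8√6π and Y(M,[g]) ≤ Y(S⁴); F5 Lee2006 Thm A (CCE with K ≤ 0 ⇒
nearby conformal
infinities fillable); F6 GrahamLee1991 (classes C^{2,α}-near round on S⁴ fill B⁵).

Novelty: Searches (2026-08-15): `lit galaxy search "conformally compact Einstein" --star all` (20 rows: Juhl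
Q-curvature book,
Marden, gauge/gravity texts, MSV/GGSU-adjacent AH scattering papers, Allen–Lee–Maxwell Sobolev-AH —
none on exotic or
homotopy-sphere boundaries); `lit search --source crossref "non-existence Poincaré-Einstein
conformal infinity"` (15:
GurskyHan2017, Anderson2008, Li Gang 2024 doi:10.1007/s11425-023-2232-0, Raulot 2022); `… "Chang Ge
Qing compactness
conformally compact Einstein perturbation uniqueness"` (12: ChangEtAl2024, Chang–Ge 2018,
Chang–Ge–Qing 2020, CQY 2004
topology of CCE 4-manifolds, Wang 2001); `… "Gursky Han Stolz invariant …"` (5: GurskyHanStolz2021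
READ pp. 3–4, 7: bulk
dimension 4k only); `lit search --source zbmath` ×2 (Hijazi–Montiel ALH rigidity, Chang Noether
lecture); `lit frontier
SmoothPoincare4 --since 2020` (30: trisections, corks, knot traces, exotic ℝ⁴ — nothing
Riemannian/holographic); `lit bridges
SmoothPoincare4 --cross any` (30, noise); `lit read` LiQingShi2017 (pp. 3–6, 8, 12–13),
GrahamEtAl2020 (pp. 3, 5, 10, 13,
27, 30), GurskySzekelyhidi2020 (p. 3, Thm 1), GurskyHanStolz2021; openalex / arXiv / S2 APIs
rate-limited (HTTP 429) this
session — recorded; `ledger negatives` (0); the 23 open SPC4 Theses files (none uses AH/PE fillings;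
RicciFat/PIC/Bach/Weyl
put curvature on Σ); related cards information-metric-hadamard, poincare-einstein-degree (4-dim
bulk, 3-sphere boundary),
yamabe-extremal-or-thin (shares Y1).
Nearest prior ar  [refs: 10.1007/s11425-023-2232-0, 10.1515/ans-2023-0124, doi:10.1007/s11425-023-2232-0, doi:10.1515/ans-2023-0124, GurskyHan2017, Anderson2008, ChangEtAl2024, GurskyHanStolz2021, LiQingShi2017, GrahamEtAl2020, GurskySzekelyhidi2020]

Barriers (technique_class: poincare-einstein-filling, visual-boundary): - technique_class: poincare-einstein-filling, visual-boundary
- Literature.Barriers.SmoothPoincare4.HCobordismBarrierFour: evaded — the 5-manifold is a FILLING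
recognised by Riemannian geometry (exp_p of a Hadamard metric and its endpoint map), not an
h-cobordism trivialised by handle moves; no h-cobordism ⇒ product step occurs (the contractible V⁵
enters only as the arena for constructing fillings in plan (b)).
- Literature.Barriers.SmoothPoincare4.TopologicalBarrierFour: evaded — nothing computed here is a
homeomorphism invariant: "Σ admits a Yamabe-near-round class bounding a PE 5-manifold" is decided by
Σ's own metrics and, by cruxes 2+5, FAILS for every exotic Σ; honest flip side: it is not computable
on a candidate, so the line has no refutation engine for SPC4.
- Literature.Barriers.SmoothPoincare4.StableBarrierFour: not engaged — no S²×S²-stabilisation;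
Yamabe constants and fillability are not stable invariants.
- Literature.Barriers.SmoothPoincare4.HCobordismInvariantBarrierFour: evaded —
fillability-near-round separates Σ from S⁴ whenever they differ (cruxes 2+5), so it is not an
h-cobordism invariant; the diffeomorphism comes from the endpoint map, not from Θ₄ = 0.
- Literature.Barriers.SmoothPoincare4.GaugeSumBarrierFour: not engaged — no gauge-theoretic or
sum-stable invariant is evaluated (the instanton-moduli bulk of information-metric-hadamard is a
different card).
- Literature.Barriers.SmoothPoincare4.CircleActionBarrierFour: heeded as a warning — no symmetry

History (route lifecycle, newest last):
- 2026-08-23T12:36:55Z · DORMANT — reconciler: no traction for 6.1 d (last activity item-evidence-added at 2026-08-17T10:13:20Z); parked, not closed — `ledger route dormant route-SmoothPoincare4- (operator:999:3473833)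

sub-problem: SmoothPoincare4 · status: dormant · opened planner-plancard-SmoothPoincare4-SmoothPoinca-83bc8ddb-0 2026-08-15T12:22:21Z · rev 7 · ledger route-SmoothPoincare4-EinsteinBulk
GENERATED by the gate from the ledger (D-0016/17). Provers cite these decls: `theorem foo : Summit.SmoothPoincare4.SmoothPoincare4.Theses.EinsteinBulk.<Decl> := …` in Summits/SmoothPoincare4/SmoothPoincare4/Theorems/<Name>.lean.
-/

namespace Summit.SmoothPoincare4.SmoothPoincare4.Theses.EinsteinBulk

open scoped BigOperators Topology Manifold Classical MeasureTheory ProbabilityTheory Matrix InnerProductSpace ComplexConjugate ContinuousMap ContDiff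
open Filter Set Function TopologicalSpace MeasureTheory

attribute [summit_statement] _root_.SmoothPoincare4

open Literature.SPC4

/-- item stmt-SmoothPoincare4-7995 · target · rank 0 · open · by planner
why it might fail: Zero slack: given cruxes 2 and 5 it is equivalent to SPC4 (S⁴ bounds ℍ⁵ with Y = Y(S⁴)); false iff an exotic 4-sphere exists; even for true Σ = S⁴-candidates no large-data PE existence engine exists in bulk dimension 5.
sources: LiQingShi2017, GrahamLee1991, Lee2006, GurskySzekelyhidi2020
[target] X: every closed smooth M ≃ₕ S⁴ has, for every δ > 0, a metric g₀ with Y(M,[g₀]) ≥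
(1−δ)·8√6π that is the conformal infinity of a C²-conformally compact Einstein (Ric = −4g)
5-manifold with |dρ|_ḡ = 1 at the boundary (card step 3, Y1 ∧ PE-FILL on spheres). -/
@[route_item "route-SmoothPoincare4-EinsteinBulk"]
def PEFilledHomotopySpheres : Prop :=
  ∀ (M : Type) [TopologicalSpace M] [T2Space M] [SecondCountableTopology M] [ChartedSpace (EuclideanSpace ℝ (Fin 4)) M] [IsManifold (𝓡 4) ∞ M] [CompactSpace M] [ConnectedSpace M] [MeasurableSpace M] [BorelSpace M], M ≃ₕ Metric.sphere (0 : EuclideanSpace ℝ (Fin 5)) 1 → ∀ δ : ℝ, 0 < δ → ∃ g₀ : Bundle.ContMDiffRiemannianMetric (𝓡 4) ∞ (EuclideanSpace ℝ (Fin 4)) (TangentSpace (𝓡 4) : M → Type _), (∀ (h' : Bundle.ContMDiffRiemannianMetric (𝓡 4) ∞ (EuclideanSpace ℝ (Fin 4)) (TangentSpace (𝓡 4) : M → Type _)) [(Literature.Geometry.Lorentzian.PseudoRiemannianMetric.ofRiemannian h').HasLeviCivita], (∃ φ : M → ℝ, ∀ x : M, 0 < φ x ∧ ∀ v w : TangentSpace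 (𝓡 4) x, h'.inner x v w = φ x * g₀.inner x v w) → (1 - δ) * (8 * Real.sqrt 6 * Real.pi) * Real.sqrt ((Literature.Geometry.Lorentzian.riemannianMeasure h' Set.univ).toReal) ≤ ∫ x, (Literature.Geometry.Lorentzian.PseudoRiemannianMetric.ofRiemannian h').scalarCurvature x ∂(Literature.Geometry.Lorentzian.riemannianMeasure h')) ∧ ∃ (N : Type) (_ : TopologicalSpace N) (_ : T2Space N) (_ : SecondCountableTopology N) (_ : ChartedSpace (EuclideanSpace ℝ (Fin 5)) N) (_ : IsManifold (𝓡 5) ∞ N) (g : Bundle.ContMDiffRiemannianMetric (𝓡 5) ∞ (EuclideanSpace ℝ (Fin 5)) (TangentSpace (𝓡 5) : N → Type _)) (_ : (Literature.Geometry.Lorentzian.PseudoRiemannianMetric.ofRiemannian g).HasLeviCivita), (∀ x, (Literature.Geometry.Lorentzian.PseudoRiemannianMetric.ofRiemannian g).ricci x = (-4 : ℝ) • (Literature.Geometry.Lorentzian.PseudoRiemannianMetric.ofRiemannian g).toBilinForm x) ∧ (∃ (X : Type) (_ : TopologicalSpace X) (_ : T2Space X) (_ : SecondCountableTopology X) (_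 : ChartedSpace (EuclideanHalfSpace 5) X) (_ : IsManifold (𝓡∂ 5) ∞ X) (_ : CompactSpace X) (_ : ConnectedSpace X) (j : N → X) (ι : M → X) (ρ : X → ℝ) (gb : Bundle.ContMDiffRiemannianMetric (𝓡∂ 5) 2 (EuclideanSpace ℝ (Fin 5)) (TangentSpace (𝓡∂ 5) : X → Type _)), Manifold.IsSmoothEmbedding (𝓡 5) (𝓡∂ 5) ∞ j ∧ Set.range j = (𝓡∂ 5).interior X ∧ Manifold.IsSmoothEmbedding (𝓡 4) (𝓡∂ 5) ∞ ι ∧ Set.range ι = (𝓡∂ 5).boundary X ∧ ContMDiff (𝓡∂ 5) 𝓘(ℝ, ℝ) ∞ ρ ∧ (∀ x : X, 0 ≤ ρ x) ∧ (∀ x : X, ρ x = 0 ↔ x ∈ (𝓡∂ 5).boundary X) ∧ (∀ y : M, ∃ ν : TangentSpace (𝓡∂ 5) (ι y), gb.inner (ι y) ν ν = 1 ∧ ∀ v : TangentSpace (𝓡∂ 5) (ι y), gb.inner (ι y) ν v = mfderiv (𝓡∂ 5) 𝓘(ℝ, ℝ) ρ (ι y) v) ∧ (∀ (x : N) (v w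 : TangentSpace (𝓡 5) x), gb.inner (j x) (mfderiv (𝓡 5) (𝓡∂ 5) j x v) (mfderiv (𝓡 5) (𝓡∂ 5) j x w) = ρ (j x) ^ 2 * g.inner x v w) ∧ (∃ φ : M → ℝ, ∀ y : M, 0 < φ y ∧ ∀ v w : TangentSpace (𝓡 4) y, gb.inner (ι y) (mfderiv (𝓡 4) (𝓡∂ 5) ι y v) (mfderiv (𝓡 4) (𝓡∂ 5) ι y w) = φ y * g₀.inner y v w))

/-- item stmt-SmoothPoincare4-7996 · crux · rank 2 · open · by planner
why it might fail: Only by mis-transcription: LQS need Ric = −(n−1)g with n = dim X = 5, C² conformal compactness (their Def 2.1 — the package grants exactly C², smooth ρ), Y in the 6|∇u|²+Ru² normalisation (= inf over conformal h' of ∫R dV/√Vol, Y(S⁴) = 8√6π); δ(ε) is ineffective.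
sources: LiQingShi2017, arXiv:1410.6402, ChruscielEtAl2005
[crux] NAMED FACT (LiQingShi2017 Thm 1.8 at n = 5, filed first per the cone rule, to be vendored in
Literature and threaded as a hypothesis): for every ε > 0 there is δ > 0 such that every conformally
compact Einstein 5-manifold (N, g), Ric_g = −4g, with C² compactification X̄ (compact, connected,
∂X̄ = M closed connected, smooth bdf ρ with |dρ|_ḡ = 1 on ∂X̄) whose conformal infinity (M,[g₀]) has
Y(M,[g₀]) ≥ (1−δ)·8√6π, satisfies |K + 1| ≤ ε for every sectional curvature K of g (orthonormal
2-frames). [difficulty: XL] -/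
@[route_item "route-SmoothPoincare4-EinsteinBulk", crux]
def YamabePinchedEinsteinBulk : Prop :=
  ∀ ε : ℝ, 0 < ε → ∃ δ : ℝ, 0 < δ ∧ ∀ (M : Type) [TopologicalSpace M] [T2Space M] [SecondCountableTopology M] [ChartedSpace (EuclideanSpace ℝ (Fin 4)) M] [IsManifold (𝓡 4) ∞ M] [CompactSpace M] [ConnectedSpace M] [MeasurableSpace M] [BorelSpace M] (g₀ : Bundle.ContMDiffRiemannianMetric (𝓡 4) ∞ (EuclideanSpace ℝ (Fin 4)) (TangentSpace (𝓡 4) : M → Type _)) (N : Type) [TopologicalSpace N] [T2Space N] [SecondCountableTopology N] [ChartedSpace (EuclideanSpace ℝ (Fin 5)) N] [IsManifold (𝓡 5) ∞ N] (g : Bundle.ContMDiffRiemannianMetric (𝓡 5) ∞ (EuclideanSpace ℝ (Fin 5)) (TangentSpace (𝓡 5) : N → Type _)) [(Literature.Geometry.Lorentzian.PseudoRiemannianMetric.ofRiemannian g).HasLeviCivita], (∀ x, (Literature.Geometry.Lorentzian.PseudoRiemannianMetric.ofRiemannian g).ricci x = (-4 : ℝ) • (Literature.Geometry.Lorentzian.PseudoRiemannianMetric.ofRiemannian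 g).toBilinForm x) → (∃ (X : Type) (_ : TopologicalSpace X) (_ : T2Space X) (_ : SecondCountableTopology X) (_ : ChartedSpace (EuclideanHalfSpace 5) X) (_ : IsManifold (𝓡∂ 5) ∞ X) (_ : CompactSpace X) (_ : ConnectedSpace X) (j : N → X) (ι : M → X) (ρ : X → ℝ) (gb : Bundle.ContMDiffRiemannianMetric (𝓡∂ 5) 2 (EuclideanSpace ℝ (Fin 5)) (TangentSpace (𝓡∂ 5) : X → Type _)), Manifold.IsSmoothEmbedding (𝓡 5) (𝓡∂ 5) ∞ j ∧ Set.range j = (𝓡∂ 5).interior X ∧ Manifold.IsSmoothEmbedding (𝓡 4) (𝓡∂ 5) ∞ ι ∧ Set.range ι = (𝓡∂ 5).boundary X ∧ ContMDiff (𝓡∂ 5) 𝓘(ℝ, ℝ) ∞ ρ ∧ (∀ x : X, 0 ≤ ρ x) ∧ (∀ x : X, ρ x = 0 ↔ x ∈ (𝓡∂ 5).boundary X) ∧ (∀ y : M, ∃ ν : TangentSpace (𝓡∂ 5) (ι y), gb.inner (ι y) ν ν = 1 ∧ ∀ v : TangentSpace (𝓡∂ 5) (ι y), gb.inner (ι y)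 ν v = mfderiv (𝓡∂ 5) 𝓘(ℝ, ℝ) ρ (ι y) v) ∧ (∀ (x : N) (v w : TangentSpace (𝓡 5) x), gb.inner (j x) (mfderiv (𝓡 5) (𝓡∂ 5) j x v) (mfderiv (𝓡 5) (𝓡∂ 5) j x w) = ρ (j x) ^ 2 * g.inner x v w) ∧ (∃ φ : M → ℝ, ∀ y : M, 0 < φ y ∧ ∀ v w : TangentSpace (𝓡 4) y, gb.inner (ι y) (mfderiv (𝓡 4) (𝓡∂ 5) ι y v) (mfderiv (𝓡 4) (𝓡∂ 5) ι y w) = φ y * g₀.inner y v w)) → (∀ (h' : Bundle.ContMDiffRiemannianMetric (𝓡 4) ∞ (EuclideanSpace ℝ (Fin 4)) (TangentSpace (𝓡 4) : M → Type _)) [(Literature.Geometry.Lorentzian.PseudoRiemannianMetric.ofRiemannian h').HasLeviCivita], (∃ φ : M → ℝ, ∀ x : M, 0 < φ x ∧ ∀ v w : TangentSpace (𝓡 4) x, h'.inner x v w = φ x * g₀.inner x v w) → (1 - δ) * (8 * Real.sqrt 6 * Real.pi) * Real.sqrt ((Literature.Geometry.Lorentzian.riemannianMeasure h' Set.univ).toReal)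 ≤ ∫ x, (Literature.Geometry.Lorentzian.PseudoRiemannianMetric.ofRiemannian h').scalarCurvature x ∂(Literature.Geometry.Lorentzian.riemannianMeasure h')) → (∀ (x : N) (X Y : TangentSpace (𝓡 5) x), g.inner x X X = 1 → g.inner x Y Y = 1 → g.inner x X Y = 0 → |(Literature.Geometry.Lorentzian.PseudoRiemannianMetric.ofRiemannian g).curvatureForm (Literature.Geometry.Lorentzian.PseudoRiemannianMetric.ofRiemannian g).leviCivita x X Y Y X + 1| ≤ ε)

/-- item stmt-SmoothPoincare4-18032 · crux · rank 3 · open · by planner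
why it might fail: False iff some exotic 4-sphere carries (1−δ)-near-round classes for every δ (σ(Σ)=σ(S⁴)): no sphere theorem from Yamabe pinching alone is known in dim 4 (CGY needs ∫|W|² < 16π²χ; near-round classes need not have small Weyl energy), and it is SPC4-shielded (no counterexample short of an exotic S⁴).
sources: doi:10.1007/s10240-003-0017-z, Kobayashi1987, Schoen1989, arXiv:math/0603486, doi:10.1090/mmono/073, LiQingShi2017
[crux] SPLIT-CHILD 2/2 of PEFillNearRound (crux-strategist BC2 redirect r1, 2026-08-17) —
YAMABE-NEAR-ROUND HOMOTOPY 4-SPHERES ARE STANDARD (the SPC4 half of PE-FILL(δ); positive form of the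
uniform Yamabe GAP for exotica, `stub_exoticYamabeGap` of the registered line standard-or-thin):
there is δ > 0 such that every closed smooth M ≃ₕ S⁴ carrying a metric g₀ with Y(M,[g₀]) ≥
(1−δ)·8√6π (metric form: (1−δ)·8√6π·√Vol(h) ≤ ∫R_h for every h conformal to g₀) is diffeomorphic to
S⁴. EXACTNESS: PEFillNearRound ⇒ this, given the Li–Qing–Shi fact (7996) and the PROVED recogniser
EinsteinHadamardFillingStandard (7999) — a PE-filled near-round class on M is pinched and
recognised; conversely this ∧ PEFillStandardSphere ⇒ PEFillNearRound by pure logic (glue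
PEFillNearRoundOfPieces, proved). SmoothPoincare4 ⇒ this trivially; this ∧ YamabeExtremalSpheres
(7998) ⇒ SmoothPoincare4. Plans: registered birth skeleton qc-smoothing
(Cruxes/PEFillNearRound/Lines/piece_X2_qc_smoothing.lean: δ-near-round ⇒ (1+ε)-quasiconformal to
round [idea green-cross-ratio-rough-graham-lee K1]; (1+ε)-qc homotopy 4-spheres are smoothable to a
diffeomorphism [Reshetnyak stability + mollification]); alternative line: Yam -/
@[route_item "route-SmoothPoincare4-EinsteinBulk"]
def YamabeNearRoundSpheresStandard : Prop :=
  ∃ δ : ℝ, 0 < δ ∧ ∀ (M : Type) [TopologicalSpace M] [T2Space M] [SecondCountableTopology M] [ChartedSpace (EuclideanSpace ℝ (Fin 4)) M] [IsManifold (𝓡 4) ∞ M] [CompactSpace M] [ConnectedSpace M] [MeasurableSpace M] [BorelSpace M], M ≃ₕ Metric.sphere (0 : EuclideanSpace ℝ (Fin 5)) 1 → ∀ (g₀ : Bundle.ContMDiffRiemannianMetric (𝓡 4) ∞ (EuclideanSpace ℝ (Fin 4)) (TangentSpace (𝓡 4) : M → Type _)), (∀ (h' : Bundle.ContMDiffRiemannianMetric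 (𝓡 4) ∞ (EuclideanSpace ℝ (Fin 4)) (TangentSpace (𝓡 4) : M → Type _)) [(Literature.Geometry.Lorentzian.PseudoRiemannianMetric.ofRiemannian h').HasLeviCivita], (∃ φ : M → ℝ, ∀ x : M, 0 < φ x ∧ ∀ v w : TangentSpace (𝓡 4) x, h'.inner x v w = φ x * g₀.inner x v w) → (1 - δ) * (8 * Real.sqrt 6 * Real.pi) * Real.sqrt ((Literature.Geometry.Lorentzian.riemannianMeasure h' Set.univ).toReal) ≤ ∫ x, (Literature.Geometry.Lorentzian.PseudoRiemannianMetric.ofRiemannian h').scalarCurvature x ∂(Literature.Geometry.Lorentzian.riemannianMeasure h')) → Nonempty (M ≃ₘ⟮𝓡 4, 𝓡 4⟯ Metric.sphere (0 : EuclideanSpace ℝ (Fin 5)) 1)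

/-- item stmt-SmoothPoincare4-7997 · crux · rank 3 · open · by planner
why it might fail: Large-data PE existence is open even on B⁵: engines are perturbative (GrahamLee1991, Lee2006) or collar-local (GurskySzekelyhidi2020); one Yamabe-near-round class on S⁴ bounding no Einstein bulk of any topology kills it; known obstructions (GurskyHan2017, GurskyHanStolz2021) need bulk dim 4k.
sources: GrahamLee1991, Lee2006, GurskySzekelyhidi2020, GurskyHan2017, GurskyHanStolz2021, Anderson2008
[crux] PE-FILL(δ) on homotopy 4-spheres (card step 3, the load-bearing conjecture): there is δ > 0
such that for every closed smooth M ≃ₕ S⁴ and every metric g₀ on M with Y(M,[g₀]) ≥ (1−δ)·8√6π there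
is a conformally compact Einstein 5-manifold (N, g), Ric = −4g, with C² compactification X̄, ∂X̄ =
M, |dρ|_ḡ = 1 on ∂X̄ and conformal infinity [g₀]. [deps: YamabePinchedEinsteinBulk] [difficulty:
open-problem] -/
@[route_item "route-SmoothPoincare4-EinsteinBulk", crux]
def PEFillNearRound : Prop :=
  ∃ δ : ℝ, 0 < δ ∧ ∀ (M : Type) [TopologicalSpace M] [T2Space M] [SecondCountableTopology M] [ChartedSpace (EuclideanSpace ℝ (Fin 4)) M] [IsManifold (𝓡 4) ∞ M] [CompactSpace M] [ConnectedSpace M] [MeasurableSpace M] [BorelSpace M], M ≃ₕ Metric.sphere (0 : EuclideanSpace ℝ (Fin 5)) 1 → ∀ (g₀ : Bundle.ContMDiffRiemannianMetric (𝓡 4) ∞ (EuclideanSpace ℝ (Fin 4)) (TangentSpace (𝓡 4) : M → Type _)), (∀ (h' : Bundle.ContMDiffRiemannianMetric (𝓡 4) ∞ (EuclideanSpace ℝ (Fin 4)) (TangentSpace (𝓡 4) : M → Type _)) [(Literature.Geometry.Lorentzian.PseudoRiemannianMetric.ofRiemannian h').HasLeviCivita], (∃ φ : M → ℝ, ∀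 x : M, 0 < φ x ∧ ∀ v w : TangentSpace (𝓡 4) x, h'.inner x v w = φ x * g₀.inner x v w) → (1 - δ) * (8 * Real.sqrt 6 * Real.pi) * Real.sqrt ((Literature.Geometry.Lorentzian.riemannianMeasure h' Set.univ).toReal) ≤ ∫ x, (Literature.Geometry.Lorentzian.PseudoRiemannianMetric.ofRiemannian h').scalarCurvature x ∂(Literature.Geometry.Lorentzian.riemannianMeasure h')) → ∃ (N : Type) (_ : TopologicalSpace N) (_ : T2Space N) (_ : SecondCountableTopology N) (_ : ChartedSpace (EuclideanSpace ℝ (Fin 5)) N) (_ : IsManifold (𝓡 5) ∞ N) (g : Bundle.ContMDiffRiemannianMetric (𝓡 5) ∞ (EuclideanSpace ℝ (Fin 5)) (TangentSpace (𝓡 5) : N → Type _)) (_ : (Literature.Geometry.Lorentzian.PseudoRiemannianMetric.ofRiemannian g).HasLeviCivita), (∀ x, (Literature.Geometry.Lorentzian.PseudoRiemannianMetric.ofRiemannian g).ricci x = (-4 : ℝ) • (Literature.Geometry.Lorentzian.PseudoRiemannianMetric.ofRiemannian g).toBilinForm x) ∧ (∃ (X : Type) (_ : TopologicalSpace X) (_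 : T2Space X) (_ : SecondCountableTopology X) (_ : ChartedSpace (EuclideanHalfSpace 5) X) (_ : IsManifold (𝓡∂ 5) ∞ X) (_ : CompactSpace X) (_ : ConnectedSpace X) (j : N → X) (ι : M → X) (ρ : X → ℝ) (gb : Bundle.ContMDiffRiemannianMetric (𝓡∂ 5) 2 (EuclideanSpace ℝ (Fin 5)) (TangentSpace (𝓡∂ 5) : X → Type _)), Manifold.IsSmoothEmbedding (𝓡 5) (𝓡∂ 5) ∞ j ∧ Set.range j = (𝓡∂ 5).interior X ∧ Manifold.IsSmoothEmbedding (𝓡 4) (𝓡∂ 5) ∞ ι ∧ Set.range ι = (𝓡∂ 5).boundary X ∧ ContMDiff (𝓡∂ 5) 𝓘(ℝ, ℝ) ∞ ρ ∧ (∀ x : X, 0 ≤ ρ x) ∧ (∀ x : X, ρ x = 0 ↔ x ∈ (𝓡∂ 5).boundary X) ∧ (∀ y : M, ∃ ν : TangentSpace (𝓡∂ 5) (ι y), gb.inner (ι y) ν ν = 1 ∧ ∀ v : TangentSpace (𝓡∂ 5) (ι y), gb.inner (ι y) ν v = mfderiv (𝓡∂ 5) 𝓘(ℝ, ℝ) ρ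 (ι y) v) ∧ (∀ (x : N) (v w : TangentSpace (𝓡 5) x), gb.inner (j x) (mfderiv (𝓡 5) (𝓡∂ 5) j x v) (mfderiv (𝓡 5) (𝓡∂ 5) j x w) = ρ (j x) ^ 2 * g.inner x v w) ∧ (∃ φ : M → ℝ, ∀ y : M, 0 < φ y ∧ ∀ v w : TangentSpace (𝓡 4) y, gb.inner (ι y) (mfderiv (𝓡 4) (𝓡∂ 5) ι y v) (mfderiv (𝓡 4) (𝓡∂ 5) ι y w) = φ y * g₀.inner y v w))

/-- item stmt-SmoothPoincare4-7998 · crux · rank 4 · open · by planner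
why it might fail: False iff some homotopy 4-sphere is Yamabe-thin (σ(Σ) < Y(S⁴)); σ is a diffeomorphism invariant that nothing computes on a candidate, and every construction reaching Y(S⁴) (Kobayashi1987 sums, Schoen1989 necks) starts from S⁴ or S¹×S³ pieces.
sources: Kobayashi1987, Schoen1989, Aubin1976, arXiv:math/0309287
[crux] Y1 (card step 3; shared with card yamabe-extremal-or-thin): every closed smooth M ≃ₕ S⁴ is
Yamabe-extremal, σ(M) = sup_[g] Y(M,[g]) = Y(S⁴): for every η > 0 there is a metric g₀ with ∫_M R_h
dV_h ≥ (1−η)·8√6π·√Vol(M,h) for every metric h conformal to g₀. [difficulty: open-problem] -/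
@[route_item "route-SmoothPoincare4-EinsteinBulk", crux]
def YamabeExtremalSpheres : Prop :=
  ∀ (M : Type) [TopologicalSpace M] [T2Space M] [SecondCountableTopology M] [ChartedSpace (EuclideanSpace ℝ (Fin 4)) M] [IsManifold (𝓡 4) ∞ M] [CompactSpace M] [MeasurableSpace M] [BorelSpace M], M ≃ₕ Metric.sphere (0 : EuclideanSpace ℝ (Fin 5)) 1 → ∀ η : ℝ, 0 < η → ∃ g₀ : Bundle.ContMDiffRiemannianMetric (𝓡 4) ∞ (EuclideanSpace ℝ (Fin 4)) (TangentSpace (𝓡 4) : M → Type _), (∀ (h' : Bundle.ContMDiffRiemannianMetric (𝓡 4) ∞ (EuclideanSpace ℝ (Fin 4)) (TangentSpace (𝓡 4) : M → Type _)) [(Literature.Geometry.Lorentzian.PseudoRiemannianMetric.ofRiemannian h').HasLeviCivita], (∃ φ : M → ℝ, ∀ x : M, 0 < φ x ∧ ∀ v w : TangentSpace (𝓡 4) x, h'.inner x v w = φ x * g₀.inner x v w) → (1 - η) * (8 * Real.sqrt 6 * Real.pi) * Real.sqrt ((Literature.Geometry.Lorentzian.riemannianMeasure h' Set.univ).toReal)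 ≤ ∫ x, (Literature.Geometry.Lorentzian.PseudoRiemannianMetric.ofRiemannian h').scalarCurvature x ∂(Literature.Geometry.Lorentzian.riemannianMeasure h'))

/-- item stmt-SmoothPoincare4-18033 · crux · rank 5 · open · by planner
why it might fail: Open even on B⁵: one Yamabe-near-round class on S⁴ (dumbbell / bubble tree with Y↑Y(S⁴), or a Yamabe 'island') bounding no PE 5-manifold of any topology kills it; engines are perturbative (GrahamLee1991, Lee2006) and CGJQ's compactness threshold δ₀ is family-dependent.
sources: GrahamLee1991, Lee2006, arXiv:2107.03075, LiQingShi2017, Anderson2008, GurskySzekelyhidi2020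
[crux] SPLIT-CHILD 1/2 of PEFillNearRound (crux-strategist BC2 redirect r1, 2026-08-17) — PE-FILL(δ)
ON THE STANDARD SMOOTH 4-SPHERE (= `stub_peFillStandard` of the registered line standard-or-thin,
verbatim): there is δ > 0 such that on every closed smooth 4-manifold DIFFEOMORPHIC to S⁴ every
metric g₀ with Y(M,[g₀]) ≥ (1−δ)·8√6π is the conformal infinity of a C²-conformally compact Einstein
5-manifold (Ric = −4g, compact connected X̄ ⊃ N, ∂X̄ = M, smooth bdf ρ, |dρ|_ḡ = 1 on ∂X̄).
Large-data Poincaré–Einstein existence on B⁵ restricted to the Yamabe-near-round cone; transversal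
to SPC4 (neither implies the other); PEFillNearRound ⇒ this by restriction (proved,
`pieces_fst_of_peFillNearRound`). Plan: registered birth skeleton valley-continuity
(Cruxes/PEFillNearRound/Lines/piece_X1_valley_continuity.lean): continuity method along smooth
one-parameter families of near-round classes from the round class — OPENNESS (Lee 2006 Thm A at K ≤
0, K ≤ 0 from Li–Qing–Shi pinching), CLOSEDNESS (Chang–Ge–Jin–Qing compactness III, arXiv:2107.03075
Thm 1.2 hypothesis (1″), uniform threshold), ROUND CLASS FILLED (ℍ⁵; item
RoundSphereBoundsHyperbolicSpace), VALLEY (near-maximal superlevel sets of -/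
@[route_item "route-SmoothPoincare4-EinsteinBulk"]
def PEFillStandardSphere : Prop :=
  ∃ δ : ℝ, 0 < δ ∧ ∀ (M : Type) [TopologicalSpace M] [T2Space M] [SecondCountableTopology M] [ChartedSpace (EuclideanSpace ℝ (Fin 4)) M] [IsManifold (𝓡 4) ∞ M] [CompactSpace M] [ConnectedSpace M] [MeasurableSpace M] [BorelSpace M], Nonempty (M ≃ₘ⟮𝓡 4, 𝓡 4⟯ Metric.sphere (0 : EuclideanSpace ℝ (Fin 5)) 1) → ∀ (g₀ : Bundle.ContMDiffRiemannianMetric (𝓡 4) ∞ (EuclideanSpace ℝ (Fin 4)) (TangentSpace (𝓡 4) : M → Type _)), (∀ (h' : Bundle.ContMDiffRiemannianMetric (𝓡 4) ∞ (EuclideanSpace ℝ (Fin 4)) (TangentSpace (𝓡 4) : M → Type _)) [(Literature.Geometry.Lorentzian.PseudoRiemannianMetric.ofRiemannian h').HasLeviCivita], (∃ φ : M → ℝ, ∀ x : M, 0 < φ x ∧ ∀ v w : TangentSpace (𝓡 4) x, h'.inner x v w = φ x * g₀.inner x v w) → (1 - δ) * (8 * Real.sqrt 6 * Real.pi) * Real.sqrt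 ((Literature.Geometry.Lorentzian.riemannianMeasure h' Set.univ).toReal) ≤ ∫ x, (Literature.Geometry.Lorentzian.PseudoRiemannianMetric.ofRiemannian h').scalarCurvature x ∂(Literature.Geometry.Lorentzian.riemannianMeasure h')) → ∃ (N : Type) (_ : TopologicalSpace N) (_ : T2Space N) (_ : SecondCountableTopology N) (_ : ChartedSpace (EuclideanSpace ℝ (Fin 5)) N) (_ : IsManifold (𝓡 5) ∞ N) (g : Bundle.ContMDiffRiemannianMetric (𝓡 5) ∞ (EuclideanSpace ℝ (Fin 5)) (TangentSpace (𝓡 5) : N → Type _)) (_ : (Literature.Geometry.Lorentzian.PseudoRiemannianMetric.ofRiemannian g).HasLeviCivita), (∀ x, (Literature.Geometry.Lorentzian.PseudoRiemannianMetric.ofRiemannian g).ricci x = (-4 : ℝ) • (Literature.Geometry.Lorentzian.PseudoRiemannianMetric.ofRiemannian g).toBilinForm x) ∧ (∃ (X : Type) (_ : TopologicalSpace X) (_ : T2Space X) (_ : SecondCountableTopology X) (_ : ChartedSpace (EuclideanHalfSpace 5) X) (_ : IsManifold (𝓡∂ 5) ∞ X) (_ : CompactSpace X) (_ : ConnectedSpace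 X) (j : N → X) (ι : M → X) (ρ : X → ℝ) (gb : Bundle.ContMDiffRiemannianMetric (𝓡∂ 5) 2 (EuclideanSpace ℝ (Fin 5)) (TangentSpace (𝓡∂ 5) : X → Type _)), Manifold.IsSmoothEmbedding (𝓡 5) (𝓡∂ 5) ∞ j ∧ Set.range j = (𝓡∂ 5).interior X ∧ Manifold.IsSmoothEmbedding (𝓡 4) (𝓡∂ 5) ∞ ι ∧ Set.range ι = (𝓡∂ 5).boundary X ∧ ContMDiff (𝓡∂ 5) 𝓘(ℝ, ℝ) ∞ ρ ∧ (∀ x : X, 0 ≤ ρ x) ∧ (∀ x : X, ρ x = 0 ↔ x ∈ (𝓡∂ 5).boundary X) ∧ (∀ y : M, ∃ ν : TangentSpace (𝓡∂ 5) (ι y), gb.inner (ι y) ν ν = 1 ∧ ∀ v : TangentSpace (𝓡∂ 5) (ι y), gb.inner (ι y) ν v = mfderiv (𝓡∂ 5) 𝓘(ℝ, ℝ) ρ (ι y) v) ∧ (∀ (x : N) (v w : TangentSpace (𝓡 5) x), gb.inner (j x) (mfderiv (𝓡 5) (𝓡∂ 5) j x v) (mfderiv (𝓡 5) (𝓡∂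 5) j x w) = ρ (j x) ^ 2 * g.inner x v w) ∧ (∃ φ : M → ℝ, ∀ y : M, 0 < φ y ∧ ∀ v w : TangentSpace (𝓡 4) y, gb.inner (ι y) (mfderiv (𝓡 4) (𝓡∂ 5) ι y v) (mfderiv (𝓡 4) (𝓡∂ 5) ι y w) = φ y * g₀.inner y v w))

/-- item stmt-SmoothPoincare4-17728 · crux · rank 6 · open · by planner
why it might fail: π₁(N)=1 must come from the boundary: K≤0 makes exp_p a covering by one-ended ℝ⁵, and the ρ-collar ≅ M×(0,a) is a simply connected sheet with compact frontier, non-compact closure (landed stub_coverSheetsSimplyConnected). Fails only if 'M ≃ₕ S⁴ ⇒ π₁M = 1' or the sheet datum resists Lean form.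
sources: GrahamEtAl2020, arXiv:1709.05053, Lee2018, EberleinOneill1973, Stallings1962
[crux] SPLIT-CHILD 1/2 of EinsteinHadamardFillingStandard (crux-strategist BC2 redirect, 2026-08-17;
the formal `route edit --split` was refused to this seat as final-cycle-only — a later split
re-attaches this item by signature): NON-TRAPPING OF HADAMARD FILLINGS OF HOMOTOPY 4-SPHERES — if
(N⁵,g) is C²-conformally compact (compact connected X̄, j : N ≅ int X̄, ι : M ≅ ∂X̄, smooth bdf ρ, ḡ
∈ C² with |dρ|_ḡ = 1 on ∂X̄, j*ḡ = ρ²g), M ≃ₕ S⁴ and K_g ≤ 0 on orthonormal pairs, then every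
g-geodesic with non-zero initial velocity eventually leaves every compact set for good (GGSU 2019 p.
10; proof plan: completeness + Cartan–Hadamard covering exp_p (landed) + π₁(N)=1 from the simply
connected ρ-collar sheet and one end of ℝ⁵ (landed stub_coverSheetsSimplyConnected,
stub_euclideanOneEnd) ⇒ exp_p diffeo ⇒ rays leave exp_p⁻¹K). why it might fail: π₁(N)=1 must come
from the boundary (K≤0 ⇒ exp_p covering by one-ended ℝ⁵; collar sheet argument) — true; risk formal
only. sources: GrahamEtAl2020, arXiv:1709.05053, Lee2018, EberleinOneill1973. Glue:
HadamardFillingNonTrapping → CompactificationConvexNearInfinity → EinsteinHadamardFillingStandard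
PROVED (Cruxes/EinsteinHadamardFillingStandard/Line -/
@[route_item "route-SmoothPoincare4-EinsteinBulk"]
def HadamardFillingNonTrapping : Prop :=
  ∀ (M : Type) [TopologicalSpace M] [T2Space M] [SecondCountableTopology M] [ChartedSpace (EuclideanSpace ℝ (Fin 4)) M] [IsManifold (𝓡 4) ∞ M] [CompactSpace M], M ≃ₕ Metric.sphere (0 : EuclideanSpace ℝ (Fin 5)) 1 → ∀ (N : Type) [TopologicalSpace N] [T2Space N] [SecondCountableTopology N] [ChartedSpace (EuclideanSpace ℝ (Fin 5)) N] [IsManifold (𝓡 5) ∞ N] (g : Bundle.ContMDiffRiemannianMetric (𝓡 5) ∞ (EuclideanSpace ℝ (Fin 5)) (TangentSpace (𝓡 5) : N → Type _)) [(Literature.Geometry.Lorentzian.PseudoRiemannianMetric.ofRiemannian g).HasLeviCivita], (∃ (X : Type) (_ : TopologicalSpace X) (_ : T2Space X) (_ : SecondCountableTopology X) (_ : ChartedSpace (EuclideanHalfSpace 5) X) (_ : IsManifold (𝓡∂ 5) ∞ X) (_ : CompactSpace X) (_ : ConnectedSpace X) (j : N → X) (ι : M → X) (ρ : X → ℝ)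 (gb : Bundle.ContMDiffRiemannianMetric (𝓡∂ 5) 2 (EuclideanSpace ℝ (Fin 5)) (TangentSpace (𝓡∂ 5) : X → Type _)), Manifold.IsSmoothEmbedding (𝓡 5) (𝓡∂ 5) ∞ j ∧ Set.range j = (𝓡∂ 5).interior X ∧ Manifold.IsSmoothEmbedding (𝓡 4) (𝓡∂ 5) ∞ ι ∧ Set.range ι = (𝓡∂ 5).boundary X ∧ ContMDiff (𝓡∂ 5) 𝓘(ℝ, ℝ) ∞ ρ ∧ (∀ x : X, 0 ≤ ρ x) ∧ (∀ x : X, ρ x = 0 ↔ x ∈ (𝓡∂ 5).boundary X) ∧ (∀ y : M, ∃ ν : TangentSpace (𝓡∂ 5) (ι y), gb.inner (ι y) ν ν = 1 ∧ ∀ v : TangentSpace (𝓡∂ 5) (ι y), gb.inner (ι y) ν v = mfderiv (𝓡∂ 5) 𝓘(ℝ, ℝ) ρ (ι y) v) ∧ (∀ (x : N) (v w : TangentSpace (𝓡 5) x), gb.inner (j x) (mfderiv (𝓡 5) (𝓡∂ 5) j x v) (mfderiv (𝓡 5) (𝓡∂ 5) j x w) = ρ (j x) ^ 2 * g.inner x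 v w)) → (∀ (x : N) (X Y : TangentSpace (𝓡 5) x), g.inner x X X = 1 → g.inner x Y Y = 1 → g.inner x X Y = 0 → (Literature.Geometry.Lorentzian.PseudoRiemannianMetric.ofRiemannian g).curvatureForm (Literature.Geometry.Lorentzian.PseudoRiemannianMetric.ofRiemannian g).leviCivita x X Y Y X ≤ 0) → ∀ γ : ℝ → N, Literature.Geometry.Lorentzian.IsGeodesic (Literature.Geometry.Lorentzian.PseudoRiemannianMetric.ofRiemannian g).leviCivita γ → Literature.Geometry.Lorentzian.velocity (𝓡 5) γ 0 ≠ 0 → ∀ K : Set N, IsCompact K → ∃ T : ℝ, ∀ t : ℝ, T ≤ t → γ t ∉ K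

/-- item stmt-SmoothPoincare4-17732 · crux · rank 7 · open · by planner
why it might fail: True at C²: on ker d(ρ∘j), Hess^g(ρ∘j) = Hess^ḡρ − ρ|dρ|²_ḡ·g needs only a bound on Hess^ḡρ (ḡ ∈ C¹ suffices). Risk is formal: the landed `SimpleAH.exists_convexity_threshold` fixes ḡ ∈ C^∞ in its signature; its chart proof (AHChartConstants needs ContDiffOn 1 Q) must be re-threaded at class 2.
sources: GrahamEtAl2020, arXiv:1709.05053, PaternainSaloUhlmann2023, LiQingShi2017, doi:10.4310/jdg/1214442281
[crux] SPLIT-CHILD 2/2 of EinsteinHadamardFillingStandard (crux-strategist BC2 redirect, 2026-08-17;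
formal --split refused to this seat as final-cycle-only — a later split re-attaches this item by
signature): CONVEXITY NEAR INFINITY AT C² COMPACTIFIED REGULARITY (GGSU 2019 p. 10: 'the regions {ρ
≥ ε} are strictly convex … for ε > 0 small enough'; Mazzeo 1988 §1; Li–Qing–Shi Def. 2.1): for
(N⁵,g) with compact X̄ ⊃ j(N) = int X̄, smooth bdf ρ ≥ 0 vanishing exactly on ∂X̄, ḡ ∈ C² with a
ḡ-unit normal ν, ḡ(ν,·) = dρ, at each boundary point, and j*ḡ = ρ²g — NO curvature sign, NO Einstein
equation, NOTHING about the boundary — there is ε₀ > 0 such that along every g-geodesic, at a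
unit-speed parameter where ρ∘j < ε₀ and (ρ∘j∘γ)' = 0, one has (ρ∘j∘γ)'' < 0. The tree PROVES it for
smooth ḡ (SimpleAH.exists_convexity_threshold, AHConvexNearInfinity.lean; its chart estimates
SimpleAH.exists_chart_constants / deriv_deriv_comp_geodesic_neg already use the chart metric only at
ContDiffOn 1); the item is that theorem at class 2. why it might fail: true at C² (only a bound on
Hess^ḡρ is needed); risk formal: re-thread the 700-line chart proof at class 2. sources:
GrahamEtAl2020, arXiv:1709.05053 -/
@[route_item "route-SmoothPoincare4-EinsteinBulk"]
def CompactificationConvexNearInfinity : Prop :=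
  ∀ (N : Type) [TopologicalSpace N] [T2Space N] [SecondCountableTopology N] [ChartedSpace (EuclideanSpace ℝ (Fin 5)) N] [IsManifold (𝓡 5) ∞ N] (g : Bundle.ContMDiffRiemannianMetric (𝓡 5) ∞ (EuclideanSpace ℝ (Fin 5)) (TangentSpace (𝓡 5) : N → Type _)) [(Literature.Geometry.Lorentzian.PseudoRiemannianMetric.ofRiemannian g).HasLeviCivita] (X : Type) [TopologicalSpace X] [T2Space X] [SecondCountableTopology X] [ChartedSpace (EuclideanHalfSpace 5) X] [IsManifold (𝓡∂ 5) ∞ X] [CompactSpace X] (j : N → X) (ρ : X → ℝ) (gb : Bundle.ContMDiffRiemannianMetric (𝓡∂ 5) 2 (EuclideanSpace ℝ (Fin 5)) (TangentSpace (𝓡∂ 5) : X → Type _)), Manifold.IsSmoothEmbedding (𝓡 5) (𝓡∂ 5) ∞ j → Set.range j = (𝓡∂ 5).interior X → ContMDiff (𝓡∂ 5) 𝓘(ℝ, ℝ) ∞ ρ → (∀ x : X, 0 ≤ ρ x) → (∀ x : X, ρ x = 0 ↔ x ∈ (𝓡∂ 5).boundary X) → (∀ z : X, z ∈ (𝓡∂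 5).boundary X → ∃ ν : TangentSpace (𝓡∂ 5) z, gb.inner z ν ν = 1 ∧ ∀ v : TangentSpace (𝓡∂ 5) z, gb.inner z ν v = mfderiv (𝓡∂ 5) 𝓘(ℝ, ℝ) ρ z v) → (∀ (x : N) (v w : TangentSpace (𝓡 5) x), gb.inner (j x) (mfderiv (𝓡 5) (𝓡∂ 5) j x v) (mfderiv (𝓡 5) (𝓡∂ 5) j x w) = ρ (j x) ^ 2 * g.inner x v w) → ∃ ε₀ : ℝ, 0 < ε₀ ∧ ∀ γ : ℝ → N, Literature.Geometry.Lorentzian.IsGeodesic (Literature.Geometry.Lorentzian.PseudoRiemannianMetric.ofRiemannian g).leviCivita γ → ∀ t₀ : ℝ, g.inner (γ t₀) (Literature.Geometry.Lorentzian.velocity (𝓡 5) γ t₀) (Literature.Geometry.Lorentzian.velocity (𝓡 5) γ t₀) = 1 → ρ (j (γ t₀)) < ε₀ → deriv (fun t ↦ ρ (j (γ t))) t₀ = 0 → deriv (deriv fun t ↦ ρ (j (γ t))) t₀ < 0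

/-- item stmt-SmoothPoincare4-7999 · support · rank 5 · closed · proved by Summit.SmoothPoincare4.SmoothPoincare4.Theorems.EinsteinHadamardFillingStandard_proof @ a21b13c50949 (prover) · by planner
why it might fail: GrahamEtAl2020 Prop 5.13 gives the endpoint diffeomorphism for SMOOTH AH compactifications; a CCE⁵ bulk is only C^{3,α}/polyhomogeneous at ∂X̄ (x⁴log x terms, ChruscielEtAl2005) and the package grants C²; the C¹ extension of the rescaled geodesic flow must be redone at that regularity.
sources: GrahamEtAl2020, arXiv:1709.05053, ChruscielEtAl2005, Stallings1962, LiQingShi2017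
[crux] Recognition (card step 1 + LQS sign, Einstein form): if a closed smooth M ≃ₕ S⁴ is the
conformal infinity of a conformally compact Einstein 5-manifold (N, g) (package as in crux 2) all of
whose sectional curvatures are ≤ 0, then M is diffeomorphic to S⁴ (N ≅ ℝ⁵ by Cartan–Hadamard + end
count; the endpoint map S_pN → ∂X̄ is a diffeomorphism). [difficulty: XL] -/
@[route_item "route-SmoothPoincare4-EinsteinBulk", crux]
def EinsteinHadamardFillingStandard : Prop :=
  ∀ (M : Type) [TopologicalSpace M] [T2Space M] [SecondCountableTopology M] [ChartedSpace (EuclideanSpace ℝ (Fin 4)) M] [IsManifold (𝓡 4) ∞ M] [CompactSpace M] [ConnectedSpace M] [MeasurableSpace M] [BorelSpace M], M ≃ₕ Metric.sphere (0 : EuclideanSpace ℝ (Fin 5)) 1 → ∀ (g₀ : Bundle.ContMDiffRiemannianMetric (𝓡 4) ∞ (EuclideanSpace ℝ (Fin 4)) (TangentSpace (𝓡 4) : M → Type _)) (N : Type) [TopologicalSpace N] [T2Space N] [SecondCountableTopology N] [ChartedSpace (EuclideanSpace ℝ (Fin 5)) N] [IsManifold (𝓡 5) ∞ N] (g : Bundle.ContMDiffRiemannianMetric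 (𝓡 5) ∞ (EuclideanSpace ℝ (Fin 5)) (TangentSpace (𝓡 5) : N → Type _)) [(Literature.Geometry.Lorentzian.PseudoRiemannianMetric.ofRiemannian g).HasLeviCivita], (∀ x, (Literature.Geometry.Lorentzian.PseudoRiemannianMetric.ofRiemannian g).ricci x = (-4 : ℝ) • (Literature.Geometry.Lorentzian.PseudoRiemannianMetric.ofRiemannian g).toBilinForm x) → (∃ (X : Type) (_ : TopologicalSpace X) (_ : T2Space X) (_ : SecondCountableTopology X) (_ : ChartedSpace (EuclideanHalfSpace 5) X) (_ : IsManifold (𝓡∂ 5) ∞ X) (_ : CompactSpace X) (_ : ConnectedSpace X) (j : N → X) (ι : M → X) (ρ : X → ℝ) (gb : Bundle.ContMDiffRiemannianMetric (𝓡∂ 5) 2 (EuclideanSpace ℝ (Fin 5)) (TangentSpace (𝓡∂ 5) : X → Type _)), Manifold.IsSmoothEmbedding (𝓡 5) (𝓡∂ 5) ∞ j ∧ Set.range j = (𝓡∂ 5).interior X ∧ Manifold.IsSmoothEmbedding (𝓡 4) (𝓡∂ 5) ∞ ι ∧ Set.range ι = (𝓡∂ 5).boundary X ∧ ContMDiff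 (𝓡∂ 5) 𝓘(ℝ, ℝ) ∞ ρ ∧ (∀ x : X, 0 ≤ ρ x) ∧ (∀ x : X, ρ x = 0 ↔ x ∈ (𝓡∂ 5).boundary X) ∧ (∀ y : M, ∃ ν : TangentSpace (𝓡∂ 5) (ι y), gb.inner (ι y) ν ν = 1 ∧ ∀ v : TangentSpace (𝓡∂ 5) (ι y), gb.inner (ι y) ν v = mfderiv (𝓡∂ 5) 𝓘(ℝ, ℝ) ρ (ι y) v) ∧ (∀ (x : N) (v w : TangentSpace (𝓡 5) x), gb.inner (j x) (mfderiv (𝓡 5) (𝓡∂ 5) j x v) (mfderiv (𝓡 5) (𝓡∂ 5) j x w) = ρ (j x) ^ 2 * g.inner x v w) ∧ (∃ φ : M → ℝ, ∀ y : M, 0 < φ y ∧ ∀ v w : TangentSpace (𝓡 4) y, gb.inner (ι y) (mfderiv (𝓡 4) (𝓡∂ 5) ι y v) (mfderiv (𝓡 4) (𝓡∂ 5) ι y w) = φ y * g₀.inner y v w)) → (∀ (x : N) (X Y : TangentSpace (𝓡 5) x), g.inner x X X = 1 → g.inner x Y Y = 1 → g.inner x X Y = 0 → (Literature.Geometry.Lorentzian.PseudoRiemannianMetric.ofRiemannian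 g).curvatureForm (Literature.Geometry.Lorentzian.PseudoRiemannianMetric.ofRiemannian g).leviCivita x X Y Y X ≤ 0) → Nonempty (M ≃ₘ⟮𝓡 4, 𝓡 4⟯ Metric.sphere (0 : EuclideanSpace ℝ (Fin 5)) 1)

/-- item stmt-SmoothPoincare4-17740 · support · rank 9 · open · by planner
sources: GrahamEtAl2020, Lee2018
[support] GLUE of the crux-strategist decomposition (BC2 redirect) of
EinsteinHadamardFillingStandard: the two registered pieces imply the crux. PROVED sorry-free —
direct term:
Summit.SmoothPoincare4.SmoothPoincare4.Cruxes.EinsteinHadamardFillingStandard.GgsuC2Redirect.einsteinHadamardFillingStandard_of_pieces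
(Cruxes/EinsteinHadamardFillingStandard/Lines/ggsu_c2_redirect.lean, commit 311e91ec0307, ≈350 lines
= the GGSU discharge re-run at C²; short form SplitV2.lean in item evidence via the LANDED
Literature theorem SimpleAH.boundary_sphere_of_convex_of_nonTrapping_of_nonpos, p140982). A prover
closes this item by landing that file under Theorems/ (prover-only) with `theorem … :
EinsteinBulk.EinsteinHadamardFillingStandardOfPieces := einsteinHadamardFillingStandard_of_pieces`
(defeq-checked: bc/glue_probe.lean rc 0). The same proof, minus the unused Einstein hypothesis,
closes HadamardFillingStandard (8000). [difficulty: provable-now] sources: GrahamEtAl2020, Lee2018 -/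
@[route_item "route-SmoothPoincare4-EinsteinBulk"]
def EinsteinHadamardFillingStandardOfPieces : Prop :=
  CompactificationConvexNearInfinity → HadamardFillingNonTrapping → EinsteinHadamardFillingStandard

/-- item stmt-SmoothPoincare4-8000 · support · rank 9 · closed · proved by Summit.SmoothPoincare4.SmoothPoincare4.Theorems.HadamardFillingStandard_proof @ 181e5c1e0fad (prover) · by planner
sources: GrahamEtAl2020, Stallings1962, arXiv:1103.3507
[support] The card's LEMMA in full (no Einstein condition): a closed smooth M ≃ₕ S⁴ that is the
conformal infinity of a C²-conformally compact, boundary-normalised (|dρ|_ḡ = 1) 5-manifold (N, g)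
with all sectional curvatures ≤ 0 is diffeomorphic to S⁴. Implies crux 5 by weakening; it is the
recogniser shared with card information-metric-hadamard. [difficulty: XL] -/
@[route_item "route-SmoothPoincare4-EinsteinBulk"]
def HadamardFillingStandard : Prop :=
  ∀ (M : Type) [TopologicalSpace M] [T2Space M] [SecondCountableTopology M] [ChartedSpace (EuclideanSpace ℝ (Fin 4)) M] [IsManifold (𝓡 4) ∞ M] [CompactSpace M] [ConnectedSpace M] [MeasurableSpace M] [BorelSpace M], M ≃ₕ Metric.sphere (0 : EuclideanSpace ℝ (Fin 5)) 1 → ∀ (g₀ : Bundle.ContMDiffRiemannianMetric (𝓡 4) ∞ (EuclideanSpace ℝ (Fin 4)) (TangentSpace (𝓡 4) : M → Type _)) (N : Type) [TopologicalSpace N] [T2Space N] [SecondCountableTopology N] [ChartedSpace (EuclideanSpace ℝ (Fin 5)) N] [IsManifold (𝓡 5) ∞ N] (g : Bundle.ContMDiffRiemannianMetric (𝓡 5) ∞ (EuclideanSpace ℝ (Fin 5)) (TangentSpace (𝓡 5) : N → Type _)) [(Literature.Geometry.Lorentzian.PseudoRiemannianMetric.ofRiemannian g).HasLeviCivita], (∃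 (X : Type) (_ : TopologicalSpace X) (_ : T2Space X) (_ : SecondCountableTopology X) (_ : ChartedSpace (EuclideanHalfSpace 5) X) (_ : IsManifold (𝓡∂ 5) ∞ X) (_ : CompactSpace X) (_ : ConnectedSpace X) (j : N → X) (ι : M → X) (ρ : X → ℝ) (gb : Bundle.ContMDiffRiemannianMetric (𝓡∂ 5) 2 (EuclideanSpace ℝ (Fin 5)) (TangentSpace (𝓡∂ 5) : X → Type _)), Manifold.IsSmoothEmbedding (𝓡 5) (𝓡∂ 5) ∞ j ∧ Set.range j = (𝓡∂ 5).interior X ∧ Manifold.IsSmoothEmbedding (𝓡 4) (𝓡∂ 5) ∞ ι ∧ Set.range ι = (𝓡∂ 5).boundary X ∧ ContMDiff (𝓡∂ 5) 𝓘(ℝ, ℝ) ∞ ρ ∧ (∀ x : X, 0 ≤ ρ x) ∧ (∀ x : X, ρ x = 0 ↔ x ∈ (𝓡∂ 5).boundary X) ∧ (∀ y : M, ∃ ν : TangentSpace (𝓡∂ 5) (ι y), gb.inner (ι y) ν ν = 1 ∧ ∀ v : TangentSpace (𝓡∂ 5) (ι y), gb.inner (ι y) ν v = mfderiv (𝓡∂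 5) 𝓘(ℝ, ℝ) ρ (ι y) v) ∧ (∀ (x : N) (v w : TangentSpace (𝓡 5) x), gb.inner (j x) (mfderiv (𝓡 5) (𝓡∂ 5) j x v) (mfderiv (𝓡 5) (𝓡∂ 5) j x w) = ρ (j x) ^ 2 * g.inner x v w) ∧ (∃ φ : M → ℝ, ∀ y : M, 0 < φ y ∧ ∀ v w : TangentSpace (𝓡 4) y, gb.inner (ι y) (mfderiv (𝓡 4) (𝓡∂ 5) ι y v) (mfderiv (𝓡 4) (𝓡∂ 5) ι y w) = φ y * g₀.inner y v w)) → (∀ (x : N) (X Y : TangentSpace (𝓡 5) x), g.inner x X X = 1 → g.inner x Y Y = 1 → g.inner x X Y = 0 → (Literature.Geometry.Lorentzian.PseudoRiemannianMetric.ofRiemannian g).curvatureForm (Literature.Geometry.Lorentzian.PseudoRiemannianMetric.ofRiemannian g).leviCivita x X Y Y X ≤ 0) → Nonempty (M ≃ₘ⟮𝓡 4, 𝓡 4⟯ Metric.sphere (0 : EuclideanSpace ℝ (Fin 5)) 1)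

/-- item stmt-SmoothPoincare4-8001 · support · rank 9 · open · by planner
sources: LiQingShi2017
[support] Glue Y1 ∧ PE-FILL → X: pure logic plus monotonicity of the Yamabe bound in λ (take η =
min(δ, δ_PE)); a 15-line proof was checked privately in the planner folder (GlueTest.lean).
[difficulty: provable-now] -/
@[route_item "route-SmoothPoincare4-EinsteinBulk"]
def FillingGlue : Prop :=
  PEFillNearRound → YamabeExtremalSpheres → PEFilledHomotopySpheres

/-- item stmt-SmoothPoincare4-8002 · support · rank 9 · open · by planner
sources: LiQingShi2017, Kirby1997
[support] The bridge from X: YamabePinchedEinsteinBulk at ε = 1/2 gives |Rm(X,Y,Y,X)+1| ≤ 1/2 hence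
K ≤ 0 on the filling produced by X at δ = δ(1/2); EinsteinHadamardFillingStandard returns M ≃ₘ S⁴,
i.e. `SmoothPoincare4` unfolded (instances: compactness from
`Literature.Topology.FourManifolds.compactSpace_of_homotopyEquiv_sphere_four_holds`, connectedness
from `pathConnectedSpace_of_homotopyEquiv`, `borel M`). [difficulty: provable-now] -/
@[route_item "route-SmoothPoincare4-EinsteinBulk"]
def TargetAssembly : Prop :=
  YamabePinchedEinsteinBulk → EinsteinHadamardFillingStandard → PEFilledHomotopySpheres → SmoothPoincare4

/-- item stmt-SmoothPoincare4-8003 · support · rank 9 · closed · proved by Summit.SmoothPoincare4.SmoothPoincare4.Cruxes.PEFillNearRound.RoundFilled.helper_roundFilled @ a6b0a8d15420 (prover) · by planner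
sources: GrahamLee1991, LiQingShi2017
[support] Non-vacuity / normalisation check of the filling package: the round S⁴ ⊂ ℝ⁵ (some metric
g₀ on it) is the conformal infinity of an Einstein (Ric = −4g) conformally compact 5-manifold with K
≡ −1 — hyperbolic 5-space in the ball model, X̄ = closed 5-ball, ρ = (1−|x|²)/2 near the boundary
suitably smoothed, ḡ = ρ²g. [difficulty: L] -/
@[route_item "route-SmoothPoincare4-EinsteinBulk"]
def RoundSphereBoundsHyperbolicSpace : Prop :=
  ∃ g₀ : Bundle.ContMDiffRiemannianMetric (𝓡 4) ∞ (EuclideanSpace ℝ (Fin 4)) (TangentSpace (𝓡 4) : (Metric.sphere (0 : EuclideanSpace ℝ (Fin 5)) 1) → Type _), ∃ (N : Type) (_ : TopologicalSpace N) (_ : T2Space N) (_ : SecondCountableTopology N) (_ : ChartedSpace (EuclideanSpace ℝ (Fin 5)) N) (_ : IsManifold (𝓡 5) ∞ N) (g : Bundle.ContMDiffRiemannianMetric (𝓡 5) ∞ (EuclideanSpace ℝ (Fin 5)) (TangentSpace (𝓡 5) : N → Type _)) (_ : (Literature.Geometry.Lorentzian.PseudoRiemannianMetric.ofRiemannian g).HasLeviCivita),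 (∀ x, (Literature.Geometry.Lorentzian.PseudoRiemannianMetric.ofRiemannian g).ricci x = (-4 : ℝ) • (Literature.Geometry.Lorentzian.PseudoRiemannianMetric.ofRiemannian g).toBilinForm x) ∧ (∃ (X : Type) (_ : TopologicalSpace X) (_ : T2Space X) (_ : SecondCountableTopology X) (_ : ChartedSpace (EuclideanHalfSpace 5) X) (_ : IsManifold (𝓡∂ 5) ∞ X) (_ : CompactSpace X) (_ : ConnectedSpace X) (j : N → X) (ι : (Metric.sphere (0 : EuclideanSpace ℝ (Fin 5)) 1) → X) (ρ : X → ℝ) (gb : Bundle.ContMDiffRiemannianMetric (𝓡∂ 5) 2 (EuclideanSpace ℝ (Fin 5)) (TangentSpace (𝓡∂ 5) : X → Type _)), Manifold.IsSmoothEmbedding (𝓡 5) (𝓡∂ 5) ∞ j ∧ Set.range j = (𝓡∂ 5).interior X ∧ Manifold.IsSmoothEmbedding (𝓡 4) (𝓡∂ 5) ∞ ι ∧ Set.range ι = (𝓡∂ 5).boundary X ∧ ContMDiff (𝓡∂ 5) 𝓘(ℝ, ℝ) ∞ ρ ∧ (∀ x : X, 0 ≤ ρ x) ∧ (∀ x :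 X, ρ x = 0 ↔ x ∈ (𝓡∂ 5).boundary X) ∧ (∀ y : (Metric.sphere (0 : EuclideanSpace ℝ (Fin 5)) 1), ∃ ν : TangentSpace (𝓡∂ 5) (ι y), gb.inner (ι y) ν ν = 1 ∧ ∀ v : TangentSpace (𝓡∂ 5) (ι y), gb.inner (ι y) ν v = mfderiv (𝓡∂ 5) 𝓘(ℝ, ℝ) ρ (ι y) v) ∧ (∀ (x : N) (v w : TangentSpace (𝓡 5) x), gb.inner (j x) (mfderiv (𝓡 5) (𝓡∂ 5) j x v) (mfderiv (𝓡 5) (𝓡∂ 5) j x w) = ρ (j x) ^ 2 * g.inner x v w) ∧ (∃ φ : (Metric.sphere (0 : EuclideanSpace ℝ (Fin 5)) 1) → ℝ, ∀ y : (Metric.sphere (0 : EuclideanSpace ℝ (Fin 5)) 1), 0 < φ y ∧ ∀ v w : TangentSpace (𝓡 4) y, gb.inner (ι y) (mfderiv (𝓡 4) (𝓡∂ 5) ι y v) (mfderiv (𝓡 4) (𝓡∂ 5) ι y w) = φ y * g₀.inner y v w)) ∧ (∀ (x : N) (X Y : TangentSpace (𝓡 5) x), g.inner x X X = 1 → g.inner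 x Y Y = 1 → g.inner x X Y = 0 → (Literature.Geometry.Lorentzian.PseudoRiemannianMetric.ofRiemannian g).curvatureForm (Literature.Geometry.Lorentzian.PseudoRiemannianMetric.ofRiemannian g).leviCivita x X Y Y X = -1)

/-- item stmt-SmoothPoincare4-8004 · assembly · rank 1 · open · by planner
sources: LiQingShi2017, GrahamEtAl2020, Kirby1997
[assembly] YamabePinchedEinsteinBulk → EinsteinHadamardFillingStandard → PEFillNearRound →
YamabeExtremalSpheres → SmoothPoincare4. -/
@[route_item "route-SmoothPoincare4-EinsteinBulk"]
def Assembly : Prop :=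
  YamabePinchedEinsteinBulk → EinsteinHadamardFillingStandard → PEFillNearRound → YamabeExtremalSpheres → SmoothPoincare4

/-! D-0027 §2.1 — DECIDING THEOREM (planner-authored via `route open/edit --closes-file`; by planner-rbadge-SmoothPoincare4-EinsteinBulk-2c6dcd3e-g2-0 2026-08-15T16:52:18Z):
its hypotheses are this route's items and its conclusion the sub-problem Statement (glue_lint), and it elaborates with this file. -/

@[closes "route-SmoothPoincare4-EinsteinBulk"] theorem closes (h_YamabePinchedEinsteinBulk : YamabePinchedEinsteinBulk)
    (h_EinsteinHadamardFillingStandard : EinsteinHadamardFillingStandard)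
    (h_PEFillNearRound : PEFillNearRound)
    (h_YamabeExtremalSpheres : YamabeExtremalSpheres) : _root_.SmoothPoincare4 := by
  unfold _root_.SmoothPoincare4 Literature.SPC4.SmoothPoincareConjectureFour
    ContinuousMap.HomotopyEquiv.NonemptyDiffeomorphSphere
  intro M _ _ _ _ _ he
  show Nonempty (M ≃ₘ⟮𝓡 4, 𝓡 4⟯ Metric.sphere (0 : EuclideanSpace ℝ (Fin (4 + 1))) 1)
  -- Instances on the homotopy 4-sphere `M` demanded by the item binders:
  -- compact (Hatcher 3.29, proved Literature fact), path connected (transported from `S⁴`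
  -- along the homotopy equivalence), Borel measurable structure.
  haveI : CompactSpace M :=
    Literature.Topology.FourManifolds.compactSpace_of_homotopyEquiv_sphere_four_holds M he
  haveI : PathConnectedSpace (Metric.sphere (0 : EuclideanSpace ℝ (Fin 5)) 1) := by
    rw [← isPathConnected_iff_pathConnectedSpace]
    refine isPathConnected_sphere ?_ 0 zero_le_one
    rw [← Module.finrank_eq_rank, finrank_euclideanSpace_fin]
    norm_num
  haveI : PathConnectedSpace M := by
    have e : (Metric.sphere (0 : EuclideanSpace ℝ (Fin 5)) 1) ≃ₕ M := he.symm
    have key : ∀ y : M, Joined (e.toFun (e.invFun y)) y := fun y =>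
      ⟨e.right_inv.some.evalAt y⟩
    refine ⟨⟨e.toFun (Classical.arbitrary _)⟩, fun y y' => ?_⟩
    have hmid : Joined (e.toFun (e.invFun y)) (e.toFun (e.invFun y')) :=
      ⟨(PathConnectedSpace.somePath (e.invFun y) (e.invFun y')).map e.toFun.continuous⟩
    exact ((key y).symm.trans hmid).trans (key y')
  letI : MeasurableSpace M := borel M
  haveI : BorelSpace M := ⟨rfl⟩
  -- The two thresholds: Li–Qing–Shi pinching at ε = 1/2, and the PE-filling threshold.
  obtain ⟨δ₂, hδ₂, H2⟩ := h_YamabePinchedEinsteinBulk (1 / 2) (by norm_num)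
  obtain ⟨δ₃, hδ₃, H3⟩ := h_PEFillNearRound
  -- Yamabe-extremality at η = min δ₂ δ₃ gives the near-round class `[g₀]`.
  obtain ⟨g₀, hY⟩ := h_YamabeExtremalSpheres M he (min δ₂ δ₃) (lt_min hδ₂ hδ₃)
  -- Monotonicity of the Yamabe lower bound in the slack parameter.
  have mono : ∀ {δ C S I : ℝ}, min δ₂ δ₃ ≤ δ → 0 ≤ C → 0 ≤ S →
      (1 - min δ₂ δ₃) * C * S ≤ I → (1 - δ) * C * S ≤ I := by
    intro δ C S I hδ hC hS h
    exact (mul_le_mul_of_nonneg_right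
      (mul_le_mul_of_nonneg_right (sub_le_sub_left hδ 1) hC) hS).trans h
  -- The Poincaré–Einstein filling of `(M, [g₀])`.
  obtain ⟨N, _, _, _, _, _, g, _, hRic, hpack⟩ := H3 M he g₀ (by
    intro h' _ hconf
    exact mono (min_le_right _ _) (by positivity) (Real.sqrt_nonneg _) (hY h' hconf))
  -- Pinching `|K + 1| ≤ 1/2` on the bulk, hence non-positive sectional curvature.
  have hpinch := H2 M g₀ N g hRic hpack (by
    intro h' _ hconf
    exact mono (min_le_left _ _) (by positivity) (Real.sqrt_nonneg _) (hY h' hconf))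
  have hK : ∀ (x : N) (X Y : TangentSpace (𝓡 5) x), g.inner x X X = 1 → g.inner x Y Y = 1 →
      g.inner x X Y = 0 →
      (Literature.Geometry.Lorentzian.PseudoRiemannianMetric.ofRiemannian g).curvatureForm
        (Literature.Geometry.Lorentzian.PseudoRiemannianMetric.ofRiemannian g).leviCivita
          x X Y Y X ≤ 0 := by
    intro x X Y hX1 hY1 hXY0
    have h := abs_le.mp (hpinch x X Y hX1 hY1 hXY0)
    linarith [h.2]
  -- Recognition: a non-positively curved Einstein filling of a homotopy 4-sphere is standard.
  exact h_EinsteinHadamardFillingStandard M he g₀ N g hRic hpack hK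

end Summit.SmoothPoincare4.SmoothPoincare4.Theses.EinsteinBulk
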